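import Summits.QuantumFields.YangMills.Theorems.BalabanLadderIRColdDoublingRecursionSC
import HarnessLib

/-!
# Sharpened MONO from the aspect bootstrap: one vacuum-dominated cold `4:1` cube controls the whole dyadic tower

Helper for crux `BalabanLadder.IR` (stmt-QuantumFields-19354), line `ym-ir7-volume-monotone-gap` (cell ym-ir, seat
ym-ir-idea-7; REDUCTION-CENSUS §L row 7).  This is the Theorems landing of the ideator's kernel answer
`Cruxes/IR/Lines/ym_ir7_mono_vs_bootstrap.lean` (v2, crux commit ec04c5caabef, idea-7 g3; answer to ym-ir-crit-2 VERDICT 15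
flag (ii) «do `extension_le` + `exc_two_mul_le_sq` discharge or sharpen MONO?»), with the one model hypothesis it still
carried ([TM-aniso] `IsTracePositive` of the Wilson family) now DISCHARGED by the tree theorem
`AspectBootstrap.tracePositive` (`Theorems/BalabanLadderIRColdDoublingRecursionSC.lean`): `mono_sharp_wilson` below is
hypothesis-free for every compact `G`, every `LatticeRep`, every `β ≥ 0`.

§1 works over the ratio representation `HasRatioRep x` of a one-box excess `x_t = Σ_{i≠i₀} rᵢ^t`, `0 ≤ rᵢ ≤ 1` —
the conclusion of `AspectBootstrap.exists_ratios`; §2 over a cube family `x : ℕ → ℕ → ℝ` (side ↦ time ↦ excess) with the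
x-currency space step `CubeExtension x` as a hypothesis; §3 discharges both hypotheses from the landed bootstrap modules
`Theorems/BalabanLadderIRDefectSquaring{OneBox,,Wilson}.lean` (`HasRatioRep` from `exists_ratios`, `CubeExtension` for
`x L t := exc (Z L L L) t` from three applications of `extension_le` — one per spatial slot, axis symmetry — plus
`exc_eq_exp_Yfun`, `Yfun_le_exc`); §4 is Wilson's action.

RESULTS (no `sorry`, no named fact):
* `x_mul_le_pow`, `x_le_pow_div`, `x_decay_of_one_time` — TIME EXTRAPOLATION WITHOUT RATE LOSS: `x_{k t₀} ≤ x_{t₀}^k`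
  for every `k ≥ 1` (generalises `exc_two_mul_le_sq`, `k = 2`); hence vacuum dominance `x_{t₀} ≤ e^{-a}` at ONE time
  gives `x_t ≤ e^{a}·e^{-(a/t₀)t}` for all `t ≥ t₀` (dyadic squaring + antitonicity certifies only half that rate
  between dyadic times).
* `anchor_tower`, `mono_sharp_dyadic` — THE SHARPENED MONO (rate uniform along the whole dyadic tower, prefactor 1): if
  ONE cube `(4n)³`, `n ≥ 2`, is vacuum-dominated at time `n` (aspect `4:1`) by `x_n ≤ e^{-a₀}`, `a₀ ≥ 2(ln 27 + 1) ≈ 8.6`,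
  then for EVERY `k` and every `t ≥ 2^k n`: `x_t((2^k·4n)³) ≤ exp(−((a₀ − 2(ln 27 + 1))/(2n))·t)` — cold-pressure
  decay at ALL larger dyadic volumes at the volume-INDEPENDENT rate `(a₀ − 8.6)/(2n)`.  Mechanism: per doubling the
  anchor exponent loses the additive `ln(27e)` (space) and is then doubled (time squaring at the new aspect-`4:1` time):
  `a_{k+1} = 2(a_k − ln 27e)`, so the tower closes iff `a₀ > 2 ln(27e)`; no `e^{432}`.
* `mono_sharp_family` (every axis-symmetric, trace-positive, volume-bounded family) and `mono_sharp_wilson` (Wilson's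
  action, every compact `G`, every `β ≥ 0`, NO further hypothesis).

READING (card `Cruxes/IR/Lines/ym-ir7-volume-monotone-gap.md` v7): in a SCALE-FREE currency MONO is DISCHARGED by the
bootstrap GIVEN ≥ 8.6 e-folds of vacuum dominance of one cold `4:1` box — idea-6's one-scale input H.  In the typed CPB
currency (`ColdPressureBound`: prefactor `C₀(2S+1)³`, cold range `t ≥ (S+1)/2`) it is NOT discharged as stated (the anchor
smallness would read `m·ℓ ≳ 12 ln(ℓ/a(β))`, a currency artefact, and the time ranges miss by one step); consequence on
record: MONO RETIRED as an independent load of LINE 1 (census v3.2).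

HONEST FRAMING: finite-size bookkeeping with ZERO Yang–Mills input (it holds for `U(1)` and every finite `G`); nothing
here proves `BalabanLadder.IR` (0/1), `IRcof`, a lattice gap, confinement or the Yang–Mills mass gap (Clay); R4 closes only
the conditional finite-𝕋⁴ rung `BalabanLadder.UV`.

References: tree `Theorems/BalabanLadderIRDefectSquaring{OneBox,,Wilson}.lean`, `…ColdDoublingRecursionSC.lean`;
M. Lüscher, Commun. Math. Phys. 54 (1977) 283 (transfer matrix); card `Cruxes/IR/MECHANISM-ym-ir-idea-6.md`.
-/

set_option autoImplicit false

namespace Summit.QuantumFields.YangMills.Cruxes.IR.VolumeMonotone.Bootstrap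

open scoped BigOperators

/-! ## §1 One box: ratio representation and time extrapolation without rate loss -/

/-- Ratio representation of a one-box excess: `x (t+2) = Σ_{i ≠ i₀} rᵢ^{t+2}` with `0 ≤ rᵢ ≤ 1`
(verbatim the conclusion of `AspectBootstrap.exists_ratios`, minus the fields not needed here). -/
def HasRatioRep (x : ℕ → ℝ) : Prop :=
  ∃ (ι : Type) (_ : DecidableEq ι) (r : ι → ℝ) (i₀ : ι), (∀ i, 0 ≤ r i ∧ r i ≤ 1) ∧
    ∀ m : ℕ, HasSum (Function.update (fun i => r i ^ (m + 2)) i₀ 0) (x (m + 2))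

section OneBox

variable {x : ℕ → ℝ}

/-- A one-box excess with a ratio representation is non-negative: `0 ≤ x_{m+2}`. -/
theorem x_nonneg (h : HasRatioRep x) (m : ℕ) : 0 ≤ x (m + 2) := by
  obtain ⟨ι, _, r, i₀, hr, hx⟩ := h
  refine (hx m).nonneg fun i => ?_
  rcases eq_or_ne i i₀ with rfl | hne
  · simp
  · rw [Function.update_of_ne hne]; exact pow_nonneg (hr i).1 _

/-- A one-box excess with a ratio representation is antitone in the time: `x_{k+2} ≤ x_{m+2}` for `m ≤ k`. -/
theorem x_antitone (h : HasRatioRep x) {m k : ℕ} (hmk : m ≤ k) : x (k + 2) ≤ x (m + 2) := by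
  obtain ⟨ι, _, r, i₀, hr, hx⟩ := h
  refine hasSum_le (fun i => ?_) (hx k) (hx m)
  rcases eq_or_ne i i₀ with rfl | hne
  · simp
  · rw [Function.update_of_ne hne, Function.update_of_ne hne]
    exact pow_le_pow_of_le_one (hr i).1 (hr i).2 (by omega)

/-- `x_{(k+1)(m+2)} ≤ x_{m+2}^{k+1}`: termwise `rᵢ^{(k+1)(m+2)} = (rᵢ^{m+2})^k · rᵢ^{m+2} ≤ x_{m+2}^k · rᵢ^{m+2}`. -/
theorem x_mul_le_pow (h : HasRatioRep x) (m k : ℕ) : x ((k + 1) * (m + 2)) ≤ x (m + 2) ^ (k + 1) := by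
  obtain ⟨ι, _, r, i₀, hr, hx⟩ := h
  have hxm := hx m
  have hxk : HasSum (Function.update (fun i => r i ^ ((k + 1) * (m + 2))) i₀ 0) (x ((k + 1) * (m + 2))) := by
    have := hx (k * (m + 2) + m)
    rwa [show k * (m + 2) + m + 2 = (k + 1) * (m + 2) from by ring] at this
  have hg0 : ∀ i, 0 ≤ Function.update (fun i => r i ^ (m + 2)) i₀ 0 i := fun i => by
    rcases eq_or_ne i i₀ with rfl | hne
    · simp
    · rw [Function.update_of_ne hne]; exact pow_nonneg (hr i).1 _
  have hterm : ∀ i, i ≠ i₀ → r i ^ (m + 2) ≤ x (m + 2) := fun i hne => by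
    have := le_hasSum hxm i fun j _ => hg0 j
    rwa [Function.update_of_ne hne] at this
  have hcmp : ∀ i, Function.update (fun i => r i ^ ((k + 1) * (m + 2))) i₀ 0 i ≤
      x (m + 2) ^ k * Function.update (fun i => r i ^ (m + 2)) i₀ 0 i := fun i => by
    rcases eq_or_ne i i₀ with rfl | hne
    · simp
    · rw [Function.update_of_ne hne, Function.update_of_ne hne,
        show (k + 1) * (m + 2) = (m + 2) * k + (m + 2) from by ring, pow_add, pow_mul]
      exact mul_le_mul_of_nonneg_right
        (pow_le_pow_left₀ (pow_nonneg (hr i).1 _) (hterm i hne) k) (pow_nonneg (hr i).1 _)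
  have := hasSum_le hcmp hxk (hxm.mul_left (x (m + 2) ^ k))
  rw [pow_succ]
  exact this

/-- Floor-power form: for every `t ≥ m+2`, `x_t ≤ x_{m+2}^{⌊t/(m+2)⌋}`. -/
theorem x_le_pow_div (h : HasRatioRep x) (m t : ℕ) (ht : m + 2 ≤ t) : x t ≤ x (m + 2) ^ (t / (m + 2)) := by
  have hq1 : 1 ≤ t / (m + 2) := (Nat.le_div_iff_mul_le (by omega)).2 (by simpa using ht)
  have hqt : t / (m + 2) * (m + 2) ≤ t := Nat.div_mul_le_self t (m + 2)
  obtain ⟨k, hk⟩ : ∃ k, t / (m + 2) = k + 1 := ⟨t / (m + 2) - 1, by omega⟩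
  rw [hk] at hqt ⊢
  have hanti : x t ≤ x ((k + 1) * (m + 2)) := by
    have h2 : 2 ≤ (k + 1) * (m + 2) := by nlinarith
    have := x_antitone h (show (k + 1) * (m + 2) - 2 ≤ t - 2 by omega)
    rwa [show t - 2 + 2 = t by omega, show (k + 1) * (m + 2) - 2 + 2 = (k + 1) * (m + 2) by omega] at this
  exact hanti.trans (x_mul_le_pow h m k)

/-- **Vacuum dominance at one time gives the full rate at all later times.**  If `x_{m+2} ≤ e^{-a}`, `a ≥ 0`
(`t₀ := m+2`), then `x_t ≤ e^{a}·e^{-(a/t₀)t}` for every `t ≥ t₀`. -/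
theorem x_decay_of_one_time (h : HasRatioRep x) {m : ℕ} {a : ℝ} (ha : 0 ≤ a) (hx : x (m + 2) ≤ Real.exp (-a))
    (t : ℕ) (ht : m + 2 ≤ t) : x t ≤ Real.exp a * Real.exp (-(a / ((m + 2 : ℕ) : ℝ)) * (t : ℝ)) := by
  have hx0 : 0 ≤ x (m + 2) := x_nonneg h m
  have h1 := x_le_pow_div h m t ht
  have hpow : x (m + 2) ^ (t / (m + 2)) ≤ Real.exp (-a) ^ (t / (m + 2)) := pow_le_pow_left₀ hx0 hx _
  have hpos : (0 : ℝ) < ((m + 2 : ℕ) : ℝ) := by positivity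
  have hqt : (t : ℝ) / ((m + 2 : ℕ) : ℝ) - 1 ≤ ((t / (m + 2) : ℕ) : ℝ) := by
    have hlt : t < t / (m + 2) * (m + 2) + (m + 2) := Nat.lt_div_mul_add (by omega)
    have hlt' : ((t : ℕ) : ℝ) ≤ ((t / (m + 2) * (m + 2) + (m + 2) : ℕ) : ℝ) := by exact_mod_cast hlt.le
    rw [sub_le_iff_le_add, div_le_iff₀ hpos]
    push_cast at hlt' ⊢
    nlinarith
  have hexp : Real.exp (-a) ^ (t / (m + 2)) ≤ Real.exp a * Real.exp (-(a / ((m + 2 : ℕ) : ℝ)) * (t : ℝ)) := by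
    rw [← Real.exp_nat_mul, ← Real.exp_add, Real.exp_le_exp]
    have := mul_le_mul_of_nonneg_right hqt ha
    have e1 : ((t : ℝ) / ((m + 2 : ℕ) : ℝ) - 1) * a = a / ((m + 2 : ℕ) : ℝ) * (t : ℝ) - a := by ring
    rw [e1] at this
    linarith
  exact h1.trans (hpow.trans hexp)

end OneBox

/-! ## §2 Cube families: the dyadic tower and the sharpened MONO -/

/-- The x-currency SPACE STEP (for `x L t = exc (Z L L L) t` of an axis-symmetric, trace-positive, volume-bounded
family: `extension_le` in each spatial slot, `Y ≤ x`, `x' = e^{Y'} − 1 ≤ 27x·e^{27x}`): for `8 ≤ L ≤ L' ≤ 2L`,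
`27·x_L(⌊L/4⌋) ≤ 1 ⟹ x_{L'}(⌊L/4⌋) ≤ 27e · x_L(⌊L/4⌋)`. -/
def CubeExtension (x : ℕ → ℕ → ℝ) : Prop :=
  ∀ L L' : ℕ, 8 ≤ L → L ≤ L' → L' ≤ 2 * L → 27 * x L (L / 4) ≤ 1 →
    x L' (L / 4) ≤ 27 * Real.exp 1 * x L (L / 4)

/-- The additive loss per doubling in the anchor exponent: `ln(27e) = ln 27 + 1 ≈ 4.30`. -/
noncomputable def lossC : ℝ := Real.log 27 + 1

/-- `exp lossC = 27·e`. -/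
theorem exp_lossC : Real.exp lossC = 27 * Real.exp 1 := by
  unfold lossC; rw [Real.exp_add, Real.exp_log (by norm_num)]

/-- `0 < lossC`. -/
theorem lossC_pos : 0 < lossC := by
  have : 0 < Real.log 27 := Real.log_pos (by norm_num)
  unfold lossC; linarith

/-- `ln 27 ≤ 2·lossC` (the smallness `27·x ≤ 1` needed by the space step follows from the anchor). -/
theorem log27_le_two_lossC : Real.log 27 ≤ 2 * lossC := by
  have : 0 < Real.log 27 := Real.log_pos (by norm_num)
  unfold lossC; linarith

section Family

variable {x : ℕ → ℕ → ℝ}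

/-- **Anchor tower.**  From `x_{4n}(n) ≤ e^{-a₀}`, `a₀ ≥ 2·lossC`: at every dyadic scale `L_k = 2^k·4n`, time
`t_k = 2^k n`: `x_{L_k}(t_k) ≤ exp(−a_k)`, `a_k = 2^k (a₀ − 2 lossC) + 2 lossC` (`a_{k+1} = 2(a_k − lossC)`). -/
theorem anchor_tower (hrep : ∀ L, 2 ≤ L → HasRatioRep (x L)) (hext : CubeExtension x)
    {n : ℕ} (hn : 2 ≤ n) {a₀ : ℝ} (ha₀ : 2 * lossC ≤ a₀) (hx : x (4 * n) n ≤ Real.exp (-a₀)) (k : ℕ) :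
    x (2 ^ k * (4 * n)) (2 ^ k * n) ≤ Real.exp (-(2 ^ k * (a₀ - 2 * lossC) + 2 * lossC)) := by
  induction k with
  | zero =>
    have e : (2 : ℝ) ^ 0 * (a₀ - 2 * lossC) + 2 * lossC = a₀ := by ring
    simpa [e] using hx
  | succ k ih =>
    have h1k : 1 ≤ 2 ^ k := Nat.one_le_two_pow
    have hLk : 4 * n ≤ 2 ^ k * (4 * n) := Nat.le_mul_of_pos_left _ (by omega)
    have hLk8 : 8 ≤ 2 ^ k * (4 * n) := by omega
    have htk : n ≤ 2 ^ k * n := Nat.le_mul_of_pos_left _ (by omega)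
    have hdiv : 2 ^ k * (4 * n) / 4 = 2 ^ k * n := by
      rw [show 2 ^ k * (4 * n) = 2 ^ k * n * 4 by ring, Nat.mul_div_cancel _ (by norm_num)]
    have hL' : 2 ^ (k + 1) * (4 * n) = 2 * (2 ^ k * (4 * n)) := by rw [pow_succ]; ring
    have ht' : 2 ^ (k + 1) * n = 2 * (2 ^ k * n) := by rw [pow_succ]; ring
    obtain ⟨m, hm⟩ : ∃ m, 2 ^ k * n = m + 2 := ⟨2 ^ k * n - 2, by omega⟩
    set ak : ℝ := 2 ^ k * (a₀ - 2 * lossC) + 2 * lossC with hak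
    have hd : 0 ≤ a₀ - 2 * lossC := by linarith
    have hak_ge : a₀ ≤ ak := by
      have h2k : (1 : ℝ) ≤ 2 ^ k := one_le_pow₀ (by norm_num)
      have := le_mul_of_one_le_left hd h2k
      rw [hak]; linarith
    have hsmall : 27 * x (2 ^ k * (4 * n)) (2 ^ k * (4 * n) / 4) ≤ 1 := by
      rw [hdiv]
      have hle : Real.exp (-ak) ≤ Real.exp (-Real.log 27) :=
        Real.exp_le_exp.2 (by linarith [log27_le_two_lossC])
      rw [Real.exp_neg (Real.log 27), Real.exp_log (by norm_num)] at hle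
      have h27 : (27 : ℝ) * 27⁻¹ = 1 := by norm_num
      have h3 : 27 * x (2 ^ k * (4 * n)) (2 ^ k * n) ≤ 27 * Real.exp (-ak) := by linarith [ih]
      have h4 : 27 * Real.exp (-ak) ≤ 27 * (27 : ℝ)⁻¹ := by linarith [hle]
      linarith
    -- space step at time `t_k`
    have hspace := hext (2 ^ k * (4 * n)) (2 * (2 ^ k * (4 * n))) hLk8 (by omega) le_rfl hsmall
    rw [hdiv] at hspace
    have hx' : x (2 * (2 ^ k * (4 * n))) (2 ^ k * n) ≤ Real.exp (-(ak - lossC)) := by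
      refine hspace.trans ?_
      rw [← exp_lossC, show -(ak - lossC) = lossC + -ak by ring, Real.exp_add]
      exact mul_le_mul_of_nonneg_left ih (Real.exp_pos _).le
    -- time step: squaring from `t_k` to `2 t_k` in the doubled cube
    have hz' : HasRatioRep (x (2 * (2 ^ k * (4 * n)))) := hrep _ (by omega)
    have hx'0 : 0 ≤ x (2 * (2 ^ k * (4 * n))) (2 ^ k * n) := by rw [hm]; exact x_nonneg hz' m
    have hsq : x (2 * (2 ^ k * (4 * n))) (2 * (2 ^ k * n)) ≤ x (2 * (2 ^ k * (4 * n))) (2 ^ k * n) ^ 2 := by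
      have := x_mul_le_pow hz' m 1
      rwa [← hm, show (1 + 1) * (2 ^ k * n) = 2 * (2 ^ k * n) by ring] at this
    rw [hL', ht']
    refine hsq.trans ?_
    have hpow : x (2 * (2 ^ k * (4 * n))) (2 ^ k * n) ^ 2 ≤ Real.exp (-(ak - lossC)) ^ 2 :=
      pow_le_pow_left₀ hx'0 hx' 2
    refine hpow.trans (le_of_eq ?_)
    rw [← Real.exp_nat_mul]
    congr 1
    rw [hak]; push_cast; ring

/-- **Sharpened MONO along the dyadic tower (θ uniform in the volume, prefactor 1).**  If one cube `(4n)³` (`n ≥ 2`)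
is vacuum-dominated at time `n` by `x_{4n}(n) ≤ e^{-a₀}` with `a₀ ≥ 2(ln 27 + 1)`, then for every `k` and every
`t ≥ 2^k n`: `x_{2^k·4n}(t) ≤ exp(−((a₀ − 2(ln 27 + 1))/(2n))·t)`. -/
theorem mono_sharp_dyadic (hrep : ∀ L, 2 ≤ L → HasRatioRep (x L)) (hext : CubeExtension x)
    {n : ℕ} (hn : 2 ≤ n) {a₀ : ℝ} (ha₀ : 2 * lossC ≤ a₀) (hx : x (4 * n) n ≤ Real.exp (-a₀))
    (k t : ℕ) (ht : 2 ^ k * n ≤ t) :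
    x (2 ^ k * (4 * n)) t ≤ Real.exp (-((a₀ - 2 * lossC) / (2 * n)) * t) := by
  have h1k : 1 ≤ 2 ^ k := Nat.one_le_two_pow
  have hLk : 4 * n ≤ 2 ^ k * (4 * n) := Nat.le_mul_of_pos_left _ (by omega)
  have htk : n ≤ 2 ^ k * n := Nat.le_mul_of_pos_left _ (by omega)
  have h2 : 2 ≤ 2 ^ k * (4 * n) := by omega
  obtain ⟨m, hm⟩ : ∃ m, 2 ^ k * n = m + 2 := ⟨2 ^ k * n - 2, by omega⟩
  have hA := anchor_tower hrep hext hn ha₀ hx k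
  have hz : HasRatioRep (x (2 ^ k * (4 * n))) := hrep _ h2
  rw [hm] at hA ht
  have h1 := x_le_pow_div hz m t ht
  have hx0 := x_nonneg hz m
  have hpow : x (2 ^ k * (4 * n)) (m + 2) ^ (t / (m + 2)) ≤
      Real.exp (-(2 ^ k * (a₀ - 2 * lossC) + 2 * lossC)) ^ (t / (m + 2)) := pow_le_pow_left₀ hx0 hA _
  refine h1.trans (hpow.trans ?_)
  rw [← Real.exp_nat_mul, Real.exp_le_exp]
  have hd : 0 ≤ a₀ - 2 * lossC := by linarith
  have hc := lossC_pos
  have hn0 : (0 : ℝ) < n := by exact_mod_cast (show 0 < n by omega)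
  have hq1 : 1 ≤ t / (m + 2) := (Nat.le_div_iff_mul_le (by omega)).2 (by simpa using ht)
  have hq1r : (1 : ℝ) ≤ ((t / (m + 2) : ℕ) : ℝ) := by exact_mod_cast hq1
  have hlt : t < t / (m + 2) * (m + 2) + (m + 2) := Nat.lt_div_mul_add (by omega)
  have hltr : ((t : ℕ) : ℝ) ≤ ((t / (m + 2) * (m + 2) + (m + 2) : ℕ) : ℝ) := by exact_mod_cast hlt.le
  push_cast at hltr
  have hmk : ((m : ℝ) + 2) = (2 : ℝ) ^ k * n := by
    have := congrArg (Nat.cast (R := ℝ)) hm; push_cast at this; linarith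
  set q : ℝ := ((t / (m + 2) : ℕ) : ℝ) with hq
  have hm2 : ((m : ℝ) + 2) ≤ q * ((m : ℝ) + 2) := le_mul_of_one_le_left (by positivity) hq1r
  have hqt : (t : ℝ) ≤ 2 * q * ((m : ℝ) + 2) := by linarith
  have step1 : (a₀ - 2 * lossC) / (2 * n) * t ≤ (a₀ - 2 * lossC) / (2 * n) * (2 * q * ((m : ℝ) + 2)) :=
    mul_le_mul_of_nonneg_left hqt (div_nonneg hd (by positivity))
  have step2 : (a₀ - 2 * lossC) / (2 * n) * (2 * q * ((m : ℝ) + 2)) = q * (2 ^ k * (a₀ - 2 * lossC)) := by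
    rw [hmk]; field_simp
  have step3 : q * (2 ^ k * (a₀ - 2 * lossC)) ≤ q * (2 ^ k * (a₀ - 2 * lossC) + 2 * lossC) :=
    mul_le_mul_of_nonneg_left (by linarith) (by positivity)
  linarith

end Family

/-! ## §3 Bridge to the landed bootstrap modules: the hypotheses discharged -/

section Bridge

open Summit.QuantumFields.YangMills.Cruxes.IR.AspectBootstrap

/-- A spectral datum (`HasSpectralDatum`, [TM]) gives the ratio representation of the excess `exc z` (`AspectBootstrap.exists_ratios`). -/
theorem hasRatioRep_of_spectralDatum {z : ℕ → ℝ} (h : HasSpectralDatum z) : HasRatioRep (exc z) := by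
  obtain ⟨ι, hdec, r, i₀, hr, -, -, -, hx⟩ := exists_ratios h
  exact ⟨ι, hdec, r, i₀, hr, hx⟩

variable {Z : ℕ → ℕ → ℕ → ℕ → ℝ}

/-- `Y_{⌊L/4⌋}(L'³) ≤ 27 · Y_{⌊L/4⌋}(L³)` for `8 ≤ L ≤ L' ≤ 2L`: `extension_le` in each of the three spatial slots. -/
theorem Yfun_cube_extension (hS : IsAxisSymmetric Z) (hT : IsTracePositive Z) (hV : HasVolumeBounds Z)
    {L L' : ℕ} (hL : 8 ≤ L) (hLL' : L ≤ L') (hL'2 : L' ≤ 2 * L) :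
    Yfun (Z L' L' L') (L / 4) ≤ 27 * Yfun (Z L L L) (L / 4) := by
  have hL2 : 2 ≤ L := by omega
  have hL'2' : 2 ≤ L' := by omega
  obtain ⟨k, hk⟩ : ∃ k, L / 4 = k + 2 := ⟨L / 4 - 2, by omega⟩
  have hLr : (0 : ℝ) < L := by exact_mod_cast (show 0 < L by omega)
  have f12 : Z L L' L' = Z L' L L' := by funext d; exact (hS L L' L' d).2.1
  have f13 : Z L L L' = Z L' L L := by funext d; exact (hS L L L' d).2.2
  have e1 := extension_le hS hT hV (b₁ := L') (b₂ := L') hL'2' hL'2' hL hLL'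
  have e2 := extension_le hS hT hV (b₁ := L) (b₂ := L') hL2 hL'2' hL hLL'
  have e3 := extension_le hS hT hV (b₁ := L) (b₂ := L) hL2 hL2 hL hLL'
  rw [f12] at e1
  rw [f13] at e2
  set r : ℝ := 3 / 2 * ((L' : ℝ) / L) with hr
  have hr0 : 0 ≤ r := by positivity
  have hr3 : r ≤ 3 := by
    have h' : ((L' : ℕ) : ℝ) ≤ ((2 * L : ℕ) : ℝ) := by exact_mod_cast hL'2
    push_cast at h'
    have : (L' : ℝ) / L ≤ 2 := by rw [div_le_iff₀ hLr]; linarith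
    rw [hr]; linarith
  have hY0 : 0 ≤ Yfun (Z L L L) (L / 4) := by rw [hk]; exact Yfun_nonneg (hT L L L hL2 hL2 hL2) k
  calc Yfun (Z L' L' L') (L / 4) ≤ r * Yfun (Z L' L L') (L / 4) := e1
    _ ≤ r * (r * Yfun (Z L' L L) (L / 4)) := mul_le_mul_of_nonneg_left e2 hr0
    _ ≤ r * (r * (r * Yfun (Z L L L) (L / 4))) :=
        mul_le_mul_of_nonneg_left (mul_le_mul_of_nonneg_left e3 hr0) hr0
    _ = r ^ 3 * Yfun (Z L L L) (L / 4) := by ring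
    _ ≤ 3 ^ 3 * Yfun (Z L L L) (L / 4) := mul_le_mul_of_nonneg_right (pow_le_pow_left₀ hr0 hr3 3) hY0
    _ = 27 * Yfun (Z L L L) (L / 4) := by norm_num

/-- The x-currency space step for the cubes of an axis-symmetric, trace-positive, volume-bounded family. -/
theorem cubeExtension_of_family (hS : IsAxisSymmetric Z) (hT : IsTracePositive Z) (hV : HasVolumeBounds Z) :
    CubeExtension (fun L t => exc (Z L L L) t) := by
  intro L L' hL hLL' hL'2 hsmall
  have hL2 : 2 ≤ L := by omega
  have hL'2' : 2 ≤ L' := by omega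
  obtain ⟨k, hk⟩ : ∃ k, L / 4 = k + 2 := ⟨L / 4 - 2, by omega⟩
  have hY := Yfun_cube_extension hS hT hV hL hLL' hL'2
  simp only at hsmall ⊢
  rw [hk] at hY hsmall ⊢
  have hz : HasSpectralDatum (Z L L L) := hT L L L hL2 hL2 hL2
  have hz' : HasSpectralDatum (Z L' L' L') := hT L' L' L' hL'2' hL'2' hL'2'
  have hx0 : 0 ≤ exc (Z L L L) (k + 2) := exc_nonneg hz k
  have hYx : Yfun (Z L L L) (k + 2) ≤ exc (Z L L L) (k + 2) := Yfun_le_exc hz k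
  rw [exc_eq_exp_Yfun hz' k]
  have h27 : Yfun (Z L' L' L') (k + 2) ≤ 27 * exc (Z L L L) (k + 2) := hY.trans (by linarith)
  have hexp := Real.exp_le_exp.2 h27
  calc Real.exp (Yfun (Z L' L' L') (k + 2)) - 1 ≤ Real.exp (27 * exc (Z L L L) (k + 2)) - 1 := by linarith
    _ ≤ 27 * exc (Z L L L) (k + 2) * Real.exp (27 * exc (Z L L L) (k + 2)) :=
        Literature.Analysis.ODE.exp_sub_one_le_mul_exp _
    _ ≤ 27 * exc (Z L L L) (k + 2) * Real.exp 1 :=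
        mul_le_mul_of_nonneg_left (Real.exp_le_exp.2 hsmall) (by positivity)
    _ = 27 * Real.exp 1 * exc (Z L L L) (k + 2) := by ring

/-- **Sharpened MONO for an abstract family** (idea-6's three properties, nothing else): one vacuum-dominated 4:1
cube `x_{4n}(n) ≤ e^{-a₀}`, `a₀ ≥ 2(ln 27 + 1)`, `n ≥ 2` ⟹ at every dyadic larger cube and every `t ≥ 2^k n`,
`exc (Z (2^k·4n)³) t ≤ exp(−((a₀ − 2(ln 27 + 1))/(2n))·t)`. -/
theorem mono_sharp_family (hS : IsAxisSymmetric Z) (hT : IsTracePositive Z) (hV : HasVolumeBounds Z)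
    {n : ℕ} (hn : 2 ≤ n) {a₀ : ℝ} (ha₀ : 2 * lossC ≤ a₀)
    (hx : exc (Z (4 * n) (4 * n) (4 * n)) n ≤ Real.exp (-a₀)) (k t : ℕ) (ht : 2 ^ k * n ≤ t) :
    exc (Z (2 ^ k * (4 * n)) (2 ^ k * (4 * n)) (2 ^ k * (4 * n))) t ≤
      Real.exp (-((a₀ - 2 * lossC) / (2 * n)) * t) :=
  mono_sharp_dyadic (x := fun L t => exc (Z L L L) t)
    (fun L hL => hasRatioRep_of_spectralDatum (hT L L L hL hL hL)) (cubeExtension_of_family hS hT hV) hn ha₀ hx k t ht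

end Bridge

/-! ## §4 Wilson's action: only [TM-aniso] left (as in `coldDoublingRecursionSC_of_tracePositive`) -/

section Wilson

open MeasureTheory
open Literature.MathematicalPhysics.QuantumFieldTheory Literature.MathematicalPhysics.QuantumLattice
open Summit.QuantumFields.YangMills.Cruxes.IR.AspectBootstrap

variable {G : Type} [Group G] [TopologicalSpace G] [IsTopologicalGroup G] [CompactSpace G]
  [MeasurableSpace G] [BorelSpace G]

/-- **Sharpened MONO for Wilson's action, every compact `G`, every lattice representation `r`, every `β ≥ 0` — NO further
hypothesis** ([TM-aniso] is the tree theorem `AspectBootstrap.tracePositive`, [Sym] `axisSymmetric`, [Vol] `volumeBounds`):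
≥ `2 ln(27e)` e-folds of vacuum dominance of ONE `(4n)³ × n` torus (`n ≥ 2`), `exc (Z_{r,β} (4n)³) n ≤ e^{−a₀}`, propagate to
cold-pressure decay `exc (Z_{r,β} (2^k·4n)³) t ≤ e^{−((a₀ − 2 ln 27e)/(2n)) t}` for every `k` and every `t ≥ 2^k n` — a rate
uniform in the volume along the whole dyadic tower, prefactor `1`. -/
theorem mono_sharp_wilson (r : LatticeRep G) {β : ℝ} (hβ : 0 ≤ β)
    {n : ℕ} (hn : 2 ≤ n) {a₀ : ℝ} (ha₀ : 2 * lossC ≤ a₀)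
    (hx : exc (wilsonFinTorusPartition r.ρ β (4 * n) (4 * n) (4 * n)) n ≤ Real.exp (-a₀))
    (k t : ℕ) (ht : 2 ^ k * n ≤ t) :
    exc (wilsonFinTorusPartition r.ρ β (2 ^ k * (4 * n)) (2 ^ k * (4 * n)) (2 ^ k * (4 * n))) t ≤
      Real.exp (-((a₀ - 2 * lossC) / (2 * n)) * t) :=
  mono_sharp_family (Z := wilsonFinTorusPartition r.ρ β) (axisSymmetric r β) (tracePositive r hβ) (volumeBounds r hβ)
    hn ha₀ hx k t ht

/-- The same with the hypothesis [TM-aniso] kept as a PARAMETER (the shape of the ideator's kernel file, for families where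
trace positivity is supplied otherwise); `mono_sharp_wilson` is this at `hT := tracePositive r hβ`. -/
theorem mono_sharp_wilson_of_tracePositive (r : LatticeRep G) {β : ℝ} (hβ : 0 ≤ β)
    (hT : IsTracePositive (wilsonFinTorusPartition r.ρ β))
    {n : ℕ} (hn : 2 ≤ n) {a₀ : ℝ} (ha₀ : 2 * lossC ≤ a₀)
    (hx : exc (wilsonFinTorusPartition r.ρ β (4 * n) (4 * n) (4 * n)) n ≤ Real.exp (-a₀))
    (k t : ℕ) (ht : 2 ^ k * n ≤ t) :
    exc (wilsonFinTorusPartition r.ρ β (2 ^ k * (4 * n)) (2 ^ k * (4 * n)) (2 ^ k * (4 * n))) t ≤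
      Real.exp (-((a₀ - 2 * lossC) / (2 * n)) * t) :=
  mono_sharp_family (Z := wilsonFinTorusPartition r.ρ β) (axisSymmetric r β) hT (volumeBounds r hβ) hn ha₀ hx k t ht

end Wilson

end Summit.QuantumFields.YangMills.Cruxes.IR.VolumeMonotone.Bootstrap
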